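import Summits.AtomisticToContinuum.BoseEinsteinCondensation.Theses.BECTangentRigidity
import Literature.MathematicalPhysics.QuantumManyBody.DyadicCoherentFraction
import Literature.MathematicalPhysics.QuantumManyBody.DyadicCoherentFractionRefinement

/-!
# Strategist sketch — crux `BECTangentRigidity.TangentTransfer` (stmt-AtomisticToContinuum-13033)

Typed forms used in `STRATEGY-CENSUS.md` (strengthenings S⁺, the candidate decompositions and
their glue). Nothing here is registered; the only `sorry`s are the census candidates, each marked.
-/

noncomputable section

open MeasureTheory Filter Set
open scoped ENNReal NNReal Topology BigOperators

namespace Summit.AtomisticToContinuum.BoseEinsteinCondensation.Cruxes.TangentTransfer.Strategist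

open Literature.MathematicalPhysics.QuantumManyBody.BoseGas
open Summit.AtomisticToContinuum.BoseEinsteinCondensation.Theses.BECTangentRigidity (TangentTransfer)

/-! ## Named per-`v` bodies (verbatim the birth line's, so everything is `Iff.rfl`-comparable) -/

/-- Floor `7N/8` at scale `ℓ` (inner body of `MesoscopicFloor`). -/
def FloorAt (v : ℝ → ℝ≥0∞) (ρ ℓ : ℝ) : Prop :=
  ∀ᶠ N : ℕ in atTop, ∃ δ : ℝ≥0∞, 0 < δ ∧ ∀ Ψ : TrialState N (sideLength ρ N),
    energy v Ψ ≤ groundStateEnergy v N (sideLength ρ N) + δ →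
    ∀ k : ℕ, ℓ ≤ sideLength ρ N / 2 ^ k → sideLength ρ N / 2 ^ k < 2 * ℓ →
      ENNReal.ofReal (7 * (N : ℝ) / 8) ≤ cohSum N (sideLength ρ N) k Ψ.ψ

/-- Rigid momentum for one `v` (per-`v` body of `RigidMomentumBound`). -/
def RigidMomentumAt (v : ℝ → ℝ≥0∞) : Prop :=
  ∃ ρ₀ : ℝ, 0 < ρ₀ ∧ ∀ ρ : ℝ, 0 < ρ → ρ < ρ₀ → ∀ ε : ℝ, 0 < ε → ∀ᶠ N : ℕ in atTop,
    ∃ δ : ℝ≥0∞, 0 < δ ∧ ∀ Ψ : TrialState N (sideLength ρ N),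
      energy v Ψ ≤ groundStateEnergy v N (sideLength ρ N) + δ →
      ∑ a : Fin 3, ∫⁻ X, (‖fderiv ℝ Ψ.ψ X (fun _ : Fin N => EuclideanSpace.single a (1 : ℝ))‖₊ : ℝ≥0∞) ^ 2 ≤
        ENNReal.ofReal (ε * (N : ℝ) ^ 2 / (sideLength ρ N) ^ 2)

/-- Coarse coherence at level `K` (per-`(v,ρ,K)` body of the target `CoarseCoherence`). -/
def CoarseAt (v : ℝ → ℝ≥0∞) (ρ : ℝ) (K : ℕ) : Prop :=
  ∀ᶠ N : ℕ in atTop, ∃ δ : ℝ≥0∞, 0 < δ ∧ ∀ Ψ : TrialState N (sideLength ρ N),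
    energy v Ψ ≤ groundStateEnergy v N (sideLength ρ N) + δ →
      ENNReal.ofReal ((N : ℝ) / 2) ≤ cohSum N (sideLength ρ N) K Ψ.ψ

/-- The crux in named form. -/
def TangentTransferNamed : Prop :=
  ∀ v : ℝ → ℝ≥0∞, IsRepulsiveFiniteRange v →
    (∃ ρ₀ : ℝ, 0 < ρ₀ ∧ ∀ ρ : ℝ, 0 < ρ → ρ < ρ₀ → ∃ ℓ : ℝ, 0 < ℓ ∧ FloorAt v ρ ℓ) →
    RigidMomentumAt v →
    ∃ ρ₀ : ℝ, 0 < ρ₀ ∧ ∀ ρ : ℝ, 0 < ρ → ρ < ρ₀ → ∃ K : ℕ, CoarseAt v ρ K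

theorem tangentTransferNamed_iff : TangentTransferNamed ↔ TangentTransfer := Iff.rfl

/-! ## § Strengthen — candidate S⁺ forms (census) -/

/-- **S⁺₁ `UniformLevelCoherence`**: coarse coherence at EVERY fixed level `K` (in particular
`K = 0`, the constant mode of `[0,L)³`), not merely at some `K`.  Strictly stronger than the
crux's conclusion; by `DyadicMonotone` the case `K = 0` implies all others. -/
def UniformLevelCoherence : Prop :=
  ∀ v : ℝ → ℝ≥0∞, IsRepulsiveFiniteRange v → RigidMomentumAt v →
    ∃ ρ₀ : ℝ, 0 < ρ₀ ∧ ∀ ρ : ℝ, 0 < ρ → ρ < ρ₀ → ∀ K : ℕ, CoarseAt v ρ K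

/-- S⁺₁ gives the crux (pure logic). -/
theorem tangentTransfer_of_uniformLevel (h : UniformLevelCoherence) : TangentTransfer := by
  rw [← tangentTransferNamed_iff]
  intro v hv _ hR
  obtain ⟨ρ₀, hρ₀, H⟩ := h v hv hR
  exact ⟨ρ₀, hρ₀, fun ρ hρ hρ' => ⟨0, H ρ hρ hρ' 0⟩⟩

/-- **S⁺₂ `PowerLawDepletion`** (infrared-bound shape): above a reference scale `r(ρ) = ρ^{-1/2}`
the TOTAL flat-mode deficit at scale `s = L/2^k` is `≤ N·(η + A (r/s)^2)` with `η ≤ 1/4`,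
uniformly in `N` and in near-minimisers — the Gaussian-domination / infrared-bound form of
condensation (`n_p ≲ 1/p²` summed over `|p| ≳ 1/s`).  Implies S⁺₁ at once (take `s = L/2^K`,
`N·A r² 4^K/L² → 0`). -/
def PowerLawDepletion : Prop :=
  ∀ v : ℝ → ℝ≥0∞, IsRepulsiveFiniteRange v → RigidMomentumAt v →
    ∃ ρ₀ : ℝ, 0 < ρ₀ ∧ ∃ η : ℝ, η ≤ 1 / 4 ∧ ∃ A : ℝ, 0 ≤ A ∧ ∀ ρ : ℝ, 0 < ρ → ρ < ρ₀ →
      ∀ᶠ N : ℕ in atTop, ∃ δ : ℝ≥0∞, 0 < δ ∧ ∀ Ψ : TrialState N (sideLength ρ N),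
        energy v Ψ ≤ groundStateEnergy v N (sideLength ρ N) + δ →
        ∀ k : ℕ, (Real.sqrt ρ)⁻¹ ≤ sideLength ρ N / 2 ^ k →
          (N : ℝ≥0∞) ≤ cohSum N (sideLength ρ N) k Ψ.ψ +
            ENNReal.ofReal ((N : ℝ) * (η + A * 4 ^ k / (ρ * sideLength ρ N ^ 2)))

/-- **S⁺₃ `HereditaryOctaveLoss`** (inductive / per-box form): the octave loss bound of the birth
line holds CELL BY CELL — for every parent cell `Q` of level `k` the eight children lose at most
the fraction `A(r/s)² + B(s/L)²` of the parent's own flat-mode occupation.  (The only form that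
could support an induction on scales; summing over `Q` gives `stub_summableOctaveLoss`.) -/
def HereditaryOctaveLoss : Prop :=
  ∀ v : ℝ → ℝ≥0∞, IsRepulsiveFiniteRange v → RigidMomentumAt v →
    ∃ ρ₀ : ℝ, 0 < ρ₀ ∧ ∃ A : ℝ, 0 ≤ A ∧ ∃ B : ℝ, 0 ≤ B ∧ ∀ ρ : ℝ, 0 < ρ → ρ < ρ₀ →
      ∀ᶠ N : ℕ in atTop, ∃ δ : ℝ≥0∞, 0 < δ ∧ ∀ Ψ : TrialState N (sideLength ρ N),
        energy v Ψ ≤ groundStateEnergy v N (sideLength ρ N) + δ →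
        ∀ k : ℕ, (Real.sqrt ρ)⁻¹ ≤ sideLength ρ N / 2 ^ (k + 1) →
          ∀ m : Fin 3 → Fin (2 ^ k),
            ∑ c : Fin 3 → Fin 2, occupation N (dyMode (sideLength ρ N) (k + 1) (dyChild m c)) Ψ.ψ ≤
              occupation N (dyMode (sideLength ρ N) k m) Ψ.ψ +
              (ENNReal.ofReal (A * 4 ^ (k + 1) / (ρ * sideLength ρ N ^ 2) + B / 4 ^ (k + 1))) *
                (occupation N (dyMode (sideLength ρ N) k m) Ψ.ψ +
                  ENNReal.ofReal ((N : ℝ) / 8 ^ (k + 1)))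

/-! ## § Decomposition — candidate typed splits (census) -/

/-- **D₁ piece 1 `GrowingFloor α`**: the floor `7N/8` at the N-DEPENDENT mesoscale `L^α`
(`0 < α < 1`), i.e. local condensation of the big-box ground state in cells of `ρ L^{3α} → ∞`
particles at fixed density. -/
def GrowingFloor (α : ℝ) : Prop :=
  ∀ v : ℝ → ℝ≥0∞, IsRepulsiveFiniteRange v →
    ∃ ρ₀ : ℝ, 0 < ρ₀ ∧ ∀ ρ : ℝ, 0 < ρ → ρ < ρ₀ →
      ∀ᶠ N : ℕ in atTop, ∃ δ : ℝ≥0∞, 0 < δ ∧ ∀ Ψ : TrialState N (sideLength ρ N),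
        energy v Ψ ≤ groundStateEnergy v N (sideLength ρ N) + δ →
        ∀ k : ℕ, (sideLength ρ N) ^ α ≤ sideLength ρ N / 2 ^ k →
          sideLength ρ N / 2 ^ k < 2 * (sideLength ρ N) ^ α →
          ENNReal.ofReal (7 * (N : ℝ) / 8) ≤ cohSum N (sideLength ρ N) k Ψ.ψ

/-- **D₁ piece 2 `MacroTransfer α`**: from the mesoscale `L^α` to a fixed level `K`, using the
rigid-momentum hypothesis (the top `(1-α) log₂ L` octaves only). -/
def MacroTransfer (α : ℝ) : Prop :=
  ∀ v : ℝ → ℝ≥0∞, IsRepulsiveFiniteRange v → RigidMomentumAt v →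
    (∃ ρ₀ : ℝ, 0 < ρ₀ ∧ ∀ ρ : ℝ, 0 < ρ → ρ < ρ₀ →
      ∀ᶠ N : ℕ in atTop, ∃ δ : ℝ≥0∞, 0 < δ ∧ ∀ Ψ : TrialState N (sideLength ρ N),
        energy v Ψ ≤ groundStateEnergy v N (sideLength ρ N) + δ →
        ∀ k : ℕ, (sideLength ρ N) ^ α ≤ sideLength ρ N / 2 ^ k →
          sideLength ρ N / 2 ^ k < 2 * (sideLength ρ N) ^ α →
          ENNReal.ofReal (7 * (N : ℝ) / 8) ≤ cohSum N (sideLength ρ N) k Ψ.ψ) →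
    ∃ ρ₀ : ℝ, 0 < ρ₀ ∧ ∀ ρ : ℝ, 0 < ρ → ρ < ρ₀ → ∃ K : ℕ, CoarseAt v ρ K

/-- The D₁ glue is pure logic: `GrowingFloor α → MacroTransfer α → TangentTransfer`
(the crux's own, Poincaré-trivial floor hypothesis is discarded). -/
theorem tangentTransfer_of_split (α : ℝ) (h₁ : GrowingFloor α) (h₂ : MacroTransfer α) :
    TangentTransfer := by
  rw [← tangentTransferNamed_iff]
  intro v hv _ hR
  exact h₂ v hv hR (h₁ v hv)

/-- **D₂ `BulkOctaves` / `BoxOctaves`** (mechanism split of the birth stub at a fixed level `K₁`):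
the box-scale piece is VACUOUS — any octave bound of the form `loss ≤ N·B/4^{k+1}` holds for
`k < K₁` as soon as `B ≥ 4^{K₁}`, because a loss never exceeds `cohSum_{k+1} ≤ N`
(`cohSum_le_card`).  Recorded as a one-line lemma so the census can point at it. -/
theorem boxOctaves_vacuous {N : ℕ} {L : ℝ} (Ψ : TrialState N L) (k K₁ : ℕ) (hk : k < K₁) :
    cohSum N L (k + 1) Ψ.ψ ≤ cohSum N L k Ψ.ψ + ENNReal.ofReal ((N : ℝ) * ((4 : ℝ) ^ K₁ / 4 ^ (k + 1))) := by
  have h1 : cohSum N L (k + 1) Ψ.ψ ≤ (N : ℝ≥0∞) := by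
    have := cohSum_le_card L (k + 1) Ψ
    simpa using this
  have h2 : (N : ℝ≥0∞) ≤ ENNReal.ofReal ((N : ℝ) * ((4 : ℝ) ^ K₁ / 4 ^ (k + 1))) := by
    have h4 : (1 : ℝ) ≤ (4 : ℝ) ^ K₁ / 4 ^ (k + 1) := by
      rw [le_div_iff₀ (by positivity), one_mul]
      exact pow_le_pow_right₀ (by norm_num) (by omega)
    calc (N : ℝ≥0∞) = ENNReal.ofReal (N : ℝ) := by simp
      _ ≤ ENNReal.ofReal ((N : ℝ) * ((4 : ℝ) ^ K₁ / 4 ^ (k + 1))) := by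
          apply ENNReal.ofReal_le_ofReal
          have hN : (0 : ℝ) ≤ N := N.cast_nonneg
          nlinarith
  exact h1.trans (h2.trans le_add_self)

end Summit.AtomisticToContinuum.BoseEinsteinCondensation.Cruxes.TangentTransfer.Strategist

end
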